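import Summits.Ventures.HSemireg.WedgeHankelRecurrenceLinearComplexity
import Summits.Ventures.HSemireg.WedgeHankelRecurrenceSymbol
import Summits.Ventures.HSemireg.WedgeHankelRecurrenceCensusSymbols

/-!
# Venture HSemireg — THE LINEAR COMPLEXITY OF A SUM: **`L(q + q′) ≤ L(q) + L(q′)`** for any two classes on `[0, N]` (the product of two full-degree recurrences is a full-degree recurrence of
# the sum, N18), with **equality for reduced symbols with coprime denominators**: `L(dualSeq m a + dualSeq m′ a′) = deg m + deg m′` when `gcd(m, m′) = gcd(m, a) = gcd(m′, a′) = 1` and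
# `2(deg m + deg m′) ≤ N + 1` (N45's addition of symbols: the sum is the dual class of the unit `a m′ + a′ m` modulo `m m′`); every dual class with a unit residue has `L = deg m`

HONEST FRAMING. Part of the Lean index of the computation cell `pub-hsemireg` (seat p10 gen 30, Sunday typer «UNIFORM-IN-n»).
LINEAR ALGEBRA OF HANKEL (catalecticant) MATRICES and of polynomials over a field ONLY: no variety, no cohomology theory, no sheaf, no Ext group and no semiregularity map is constructed
here; nothing here says that HC / HC_CM / HC_AV holds; no Literature fact is declared or used.  Custodian versions as in `WedgeHankelSiegelIdeal` (1/3); the dictionary («`L(s + t) ≤ L(s) + L(t)`,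
with equality when the minimal polynomials are coprime», Rueppel 1986 ∕ Lidl–Niederreiter Thm 8.57) is QUOTED in docstrings, never asserted; linear complexity = `IsLeast` of the inline set
`S^N(q)` as in N70.

WHAT IS IN THE TREE.  N70 (`WedgeHankelRecurrenceLinearComplexity`, № 436): `isLeast_setOf_lfsr_of_isAffineClass`, `succ_level_mem_setOf_lfsr`; N45 (№ 327): `dualSeq_add_dualSeq`, `isCoprime_mul_add_mul`;
N46 (`WedgeHankelRecurrenceCensusSymbols`, № 328): `isAffineClass_dualSeq` (a reduced symbol is affine of rank `deg m`; REUSED); N18 (№ 173): `mul_mem_recSpace_add_seq`, `recSpace_smul_seq`.  Mathlib: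
`Polynomial.natDegree_mul`, `Polynomial.Monic.mul`, `IsLeast`.
THIS FILE (namespace `Summit.Ventures.HSemireg.Wedge.HankelOuter` continued; PLAIN on N70 + N45 + N46; 0 definitions):
* §640 `add_mem_setOf_lfsr_add` (`k ∈ S(q)`, `k′ ∈ S(q′) ⇒ k + k′ ∈ S(q + q′)`), **`isLeast_setOf_lfsr_add_le`** (`L(q + q′) ≤ L(q) + L(q′)`), `setOf_lfsr_smul` (`S(c·q) = S(q)`, `c ≠ 0`),
  **`isLeast_setOf_lfsr_dualSeq`** (`L(dualSeq m a) = deg m` for `gcd(m, a) = 1`, `2 deg m ≤ N + 1`),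
  **`isLeast_setOf_lfsr_dualSeq_add_dualSeq`** (EQUALITY: `L(dualSeq m a + dualSeq m′ a′) = deg m + deg m′` for coprime data, `2(deg m + deg m′) ≤ N + 1`).
Nothing Ext-side.  New names only.
-/

open Module Polynomial
open scoped Matrix Polynomial

namespace Summit.Ventures.HSemireg.Wedge.HankelOuter

open Summit.Ventures.HSemireg.Wedge Summit.Ventures.HSemireg.Wedge.Hankel

variable (K : Type*) [Field K] {N : ℕ}

/-! ## §640. Sums -/

/-- **`k ∈ S(q)`, `k′ ∈ S(q′) ⇒ k + k′ ∈ S(q + q′)`**: the product of two full-degree recurrences is a full-degree recurrence of the sum (N18). -/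
theorem add_mem_setOf_lfsr_add {q q' : ℕ → K} {k k' : ℕ} (hk : k ∈ {k : ℕ | ∃ p ∈ recSpace K N q k, p ≠ 0 ∧ p.natDegree = k})
    (hk' : k' ∈ {k : ℕ | ∃ p ∈ recSpace K N q' k, p ≠ 0 ∧ p.natDegree = k}) : k + k' ∈ {k : ℕ | ∃ p ∈ recSpace K N (q + q') k, p ≠ 0 ∧ p.natDegree = k} := by
  obtain ⟨p, hp, hp0, hpd⟩ := hk
  obtain ⟨p', hp', hp0', hpd'⟩ := hk'
  exact ⟨p * p', mul_mem_recSpace_add_seq K hp hp', mul_ne_zero hp0 hp0', by rw [Polynomial.natDegree_mul hp0 hp0', hpd, hpd']⟩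

/-- **`L(q + q′) ≤ L(q) + L(q′)`** for the linear complexities (`IsLeast` values) of any two classes on `[0, N]`. -/
theorem isLeast_setOf_lfsr_add_le {q q' : ℕ → K} {L L' M : ℕ} (hL : IsLeast {k : ℕ | ∃ p ∈ recSpace K N q k, p ≠ 0 ∧ p.natDegree = k} L)
    (hL' : IsLeast {k : ℕ | ∃ p ∈ recSpace K N q' k, p ≠ 0 ∧ p.natDegree = k} L') (hM : IsLeast {k : ℕ | ∃ p ∈ recSpace K N (q + q') k, p ≠ 0 ∧ p.natDegree = k} M) : M ≤ L + L' :=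
  hM.2 (add_mem_setOf_lfsr_add K hL.1 hL'.1)

/-- `S(c·q) = S(q)` for `c ≠ 0` (same recurrences). -/
theorem setOf_lfsr_smul {c : K} (hc : c ≠ 0) (q : ℕ → K) :
    {k : ℕ | ∃ p ∈ recSpace K N (c • q) k, p ≠ 0 ∧ p.natDegree = k} = {k : ℕ | ∃ p ∈ recSpace K N q k, p ≠ 0 ∧ p.natDegree = k} := by
  ext k
  simp only [Set.mem_setOf_eq, recSpace_smul_seq K hc]

/-- **`L(dualSeq m a) = deg m`** for a reduced symbol (`gcd(m, a) = 1`, `2 deg m ≤ N + 1`). -/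
theorem isLeast_setOf_lfsr_dualSeq {m a : K[X]} (hm : m.Monic) (hcop : IsCoprime m a) (h2 : m.natDegree + m.natDegree ≤ N + 1) :
    IsLeast {k : ℕ | ∃ p ∈ recSpace K N (dualSeq K m a) k, p ≠ 0 ∧ p.natDegree = k} m.natDegree :=
  isLeast_setOf_lfsr_of_isAffineClass K (isAffineClass_dualSeq K hm hcop h2)

/-- **EQUALITY FOR COPRIME DENOMINATORS: `L(dualSeq m a + dualSeq m′ a′) = deg m + deg m′`** for monic `m`, `m′` with `gcd(m, m′) = gcd(m, a) = gcd(m′, a′) = 1` and `2(deg m + deg m′) ≤ N + 1`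
(the sum is the reduced symbol `(a m′ + a′ m)/(m m′)`, N45). -/
theorem isLeast_setOf_lfsr_dualSeq_add_dualSeq {m m' a a' : K[X]} (hm : m.Monic) (hm' : m'.Monic) (hmm' : IsCoprime m m') (hma : IsCoprime m a) (hm'a' : IsCoprime m' a')
    (h2 : (m.natDegree + m'.natDegree) + (m.natDegree + m'.natDegree) ≤ N + 1) :
    IsLeast {k : ℕ | ∃ p ∈ recSpace K N (dualSeq K m a + dualSeq K m' a') k, p ≠ 0 ∧ p.natDegree = k} (m.natDegree + m'.natDegree) := by
  have hdeg : (m * m').natDegree = m.natDegree + m'.natDegree := Polynomial.natDegree_mul hm.ne_zero hm'.ne_zero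
  rw [dualSeq_add_dualSeq K hm hm', ← hdeg]
  exact isLeast_setOf_lfsr_dualSeq K (hm.mul hm') (isCoprime_mul_add_mul K hmm' hma hm'a') (by rw [hdeg]; exact h2)

end Summit.Ventures.HSemireg.Wedge.HankelOuter
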